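import Literature.MathematicalPhysics.QuantumFieldTheory.Balaban1983to89.B6FullWindowReachV1L0

/-!
# `Balaban1983to89.B6FullWindowReachV1L3` — T. Bałaban, *Propagators and renormalization transformations for lattice gauge theories. II*,
# Commun. Math. Phys. **96** (1984) 223–250 [Balaban1984PropagatorsII], (2.133) p. 247 with p. 238 (*"we take the cube □̃³ and identify it with a
# torus T_□"*): THE (2.133) REACH MAJORANT OF THE FULL-WINDOW TRANSPLANT OF `G_□` WITH THE REACH IN A **SHIFTED** HALF-PERIOD SUB-WINDOW
# (sub-row G-F3′-L0∕L3 of programme G-F3′-L0, joint J11′ of the B6 owner's PLAN v1.5 §13; design probe `lit-balaban-p21/L3-ROOTS.md` §5–§8)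

statement-level skeleton of published theorems with citation tags; proofs where landed; nothing here is a claim about the Yang–Mills mass gap

PDF held: `paper:balaban1984-cmp96-propagators-rt-ii` (journal page = PDF page + 222): p. 238 [PDF 16] (*"□ ⊂ □̃ ⊂ □̃² ⊂ □̃³ … we take the cube □̃³ and
identify it with a torus, denoted by T_□"* — the cube sits IN THE MIDDLE of its torus), p. 247 [PDF 25] ((2.133): *"|(G_□J)(x)|, |(∇G_□J)(x)| ≤
O(1)[(L^jη)², L^jη]e^{−δ₂|y−y′|}|J| for x ∈ Δ(y), supp J ⊂ Δ(y′), y, y′ ∈ 𝔅 ∩ T_□"*).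

CITATION HEADER (lean-in-tree rule) — WHAT IS REPRODUCED.  Phase-2 file of the `lit-balaban` typed skeleton (HOME `run/shared/lean/pub/lit-balaban/`),
seat **p21 gen 29** (allocation of record: B6 owner r03 gen 37, PLAN v1.5 §13, 2026-08-27T22:25:57Z); SKELETON rows **B6.Eq2.133** × B6.Prop2.6 (cells).
The lineage's `B6FullWindowReachV1(L0).reach2133_G_V1_full` reads the reach `S` of a cube in the LOWER half-period sub-window `[x₀, x₀ + Wd)` of the
member's full window `[x₀, x₀ + 2L^{m_□+K_□})` — the SAME corner as the chart.  With the cube RE-CENTRED in its window (the L3 root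
`B6CubeWindowV1L3`: corner `x0C = ctr − (2L−1)S_j/2`, so that EVERY odd `L ≥ 3` has a torus-distance margin between the reach `□⁺` and the wrap point
of `T_□`) the reach sits in the MIDDLE of the full window, i.e. in a half-period sub-window `[x₁, x₁ + Wd₁)` with a corner `x₁ ∈ x₀ + L^jℤ^{d+1}`,
`x₁ ≥ x₀`, DIFFERENT from `x₀` (at `L = 3` the reach `□⁺` is exactly a half period wide, so no anchoring at `x₀` has a margin).  r03's bridge
`B6Prop26ReachTransplant.localMajorant_transplant_of_window₂` / `reach2133_G₂` (v2 of that file) IS the transplant through a large (here: bijective) window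
with the reach in a shifted half-period sub-window; THIS FILE supplies its two downstream exports on the V1 global torus:
* §1 **`hfib_sites_full`** — the fibre input of the bridge (`≤ L^{d+1}` charted `j`-blocks over a global block of level `j`/`j+1`) for a window of side up
  to the FULL fine period `2L^{m_□+K_□}` of `T_□` (the lineage's `B6Prop26ReachTransplantL0.hfib_sites` asks `Wd ≤ L^{m+K}`; its proof uses that bound only
  to place the charted point in the fundamental domain, which `Wd ≤ 2L^{m+K}` gives directly);
* §2 **`reach2133_G_V1₂`** — `B6GlobalChartV1L0.reach2133_G_V1` with the window enlarged up to the full period and the reach confined to a shifted half-period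
  sub-window `[x₁, x₁ + Wd₁)`, `L^j ∣ x₁ − x₀`, `x₀ ≤ x₁`, `Wd₁ ≤ L^{m_□+K_□}`: SAME constants `δ, A`, SAME conclusion
  `LocalMajorant (blkV1 hN D) (GlV1 t hN W x₀) S (L^{d+1}·A·e^{2δ}·e^{−(δ/(d+1))·d_T})`;
* §3 **`reach2133_G_V1_full₂`** — the same for the FULL bond window `(cB t x₀ hx₀ hfit).W` of `B6AgreeLapV1Chart` (the window that carries `hinvl`), two-level
  on the full window: the `h2133`-type input of the re-centred cube's `B6CubeWindowV1L3.h2133C`.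
THEOREMS ONLY (no `def`); no new fact; standard axioms; nothing of the lineage is restated (the `x₀`-anchored versions stay in `…V1L0`, by name).

HONEST SCOPE / DIVERGENCES. (1) Pure bookkeeping over r03's `…window₂` bridge: the analytic content is p38's `ineq2133_G` (2.133) for the two-scale member,
unchanged; the rate `δ/(d+1)` and the factor `L^{d+1}` are the lineage's (print: `½δ₂`, `O(1)`). (2) The `∇G_□` twin (`reach2133_DG₂` → V1) is not
exported here (no consumer in the sub-row: the cube's derivative legs go through the corner-agnostic band bridge `B6InDecayWindowV1L0`). (3) Value =
the one non-mechanical joint of the `L = 3` re-anchoring made available by name; NOT summit progress.  Unit `lit-balaban-p21` (gen 29), 2026-08-27.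
-/

noncomputable section

open scoped BigOperators
open Finset

namespace Literature.MathematicalPhysics.QuantumFieldTheory.Balaban1983to89.B6FullWindowReachV1L3

open B6Prop26Gluing (LocalMajorant)
open B6RandomWalk (HasMajorant)
open B6Prop26ReachTransplant (transplant chartBond chartBond_src InWindow rep_iterBlockOf_siteOfInt reach2133_G₂)
open B4Reflection242 (boxDom mem_boxDom)
open B4ContourShift (supNorm)
open B5Eq118OneStroke (iterBlockOf)
open B6LowerBound2153Torus (rep)
open B5Eq117TorusCarriers (Mk)
open B6MultiLevelBoxOperator (N0)
open B6MultiLevelBoxOperatorL0 (Domains)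
open B6MultiLevelTorusOperatorL0 (TDomains)
open B6Geom246MultiLevelBoxL0 (bset blkOf geom bond coord_bounds lev_eq_of_blkOf_eq)
open B6Geom246MultiLevelTorusL0 (geomT bondT distT_le_dist_box)
open B6Prop25TwoScaleCensus (TSIdx)
open B6Ineq2133TwoScaleV1 (onFun)
open B6Prop26ReachTransplantL0 (hglob_sites)
open B6GlobalChartV1 (PV toBox toBox_apply toBox_injective GlV1)
open B6GlobalChartV1L0 (blkV1)
open B6AgreeLapV1Chart (cB DeepS mem_cB_W)

variable {d ℓ : ℕ} {hd : 1 ≤ d + 1} {hL : Odd (ℓ + 1) ∧ 1 < ℓ + 1} {a₀ a₁ : ℝ}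

/-! ## §1  The fibre input for a window of side up to the full fine period of `T_□` -/

section Fibre

variable (t : TSIdx d (ℓ + 1) hd hL a₀ a₁) {Mh k R : ℕ} {P : Fin (d + 1) → ℕ} (D : Domains d ℓ Mh k P R)

/-- `rep` is injective: a site of `T^{(j)}` is determined by its labels. [folklore] -/
private theorem rep_injective : Function.Injective (rep (Mk t.P t.j) : Site t.P t.j → Fin (d + 1) → ℤ) := by
  intro y y' h
  funext μ
  have hμ := congrFun h μ
  simp only [rep, Nat.cast_inj] at hμ
  exact ZMod.val_injective _ hμ

/-- **THE FIBRE INPUT FOR A WINDOW OF SIDE UP TO THE FULL PERIOD `2L^{m_□+K_□}`**: `≤ L^{d+1}` charted `j`-blocks over a global block of level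
`j` or `j + 1` meeting the window (corner in `L^jℤ^{d+1}`) — `B6Prop26ReachTransplantL0.hfib_sites` with `Wd ≤ L^{m+K}` relaxed to
`Wd ≤ 2L^{m+K}` (the fundamental domain of `T_□`). [cite: Balaban1984PropagatorsII, (2.1) p.224, (2.89) p.239, p.238 (T_□ = □̃³); Balaban1984PropagatorsI, (1.16)–(1.18) p.20] -/
theorem hfib_sites_full {X : Type} (site : X → ↥(boxDom (N0 ℓ Mh k P))) (dir : X → Fin (d + 1)) (x₀ : Fin (d + 1) → ℤ)
    (hx₀ : ∀ μ, (((ℓ + 1) ^ t.j : ℕ) : ℤ) ∣ x₀ μ) (Wd : ℕ) (hWd : Wd ≤ t.P.sitesPerDir 0)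
    (hlev : ∀ z ∈ boxDom (N0 ℓ Mh k P), (∀ μ, x₀ μ ≤ z μ ∧ z μ < x₀ μ + Wd) → t.j ≤ D.lev z ∧ D.lev z ≤ t.j + 1)
    (W : Finset X) (hW : ∀ x ∈ W, InWindow (fun x => (site x : Fin (d + 1) → ℤ)) x₀ Wd x) (y : ↥(bset D)) :
    ∃ T : Finset (Site t.P t.j), T.card ≤ (ℓ + 1) ^ (d + 1) ∧ ∀ x ∈ W, blkOf D (site x) = y → iterBlockOf t.j
      (chartBond t (fun x => (site x : Fin (d + 1) → ℤ)) dir x₀ x).src ∈ T := by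
  classical
  set F := (W.filter (fun x => blkOf D (site x) = y)).image (fun x => iterBlockOf t.j
      (chartBond t (fun x => (site x : Fin (d + 1) → ℤ)) dir x₀ x).src) with hF
  have hmemF : ∀ x ∈ W, blkOf D (site x) = y → iterBlockOf t.j
      (chartBond t (fun x => (site x : Fin (d + 1) → ℤ)) dir x₀ x).src ∈ F := fun x hx hxy =>
    Finset.mem_image.mpr ⟨x, Finset.mem_filter.mpr ⟨hx, hxy⟩, rfl⟩
  refine ⟨F, ?_, hmemF⟩
  by_cases hne : (W.filter (fun x => blkOf D (site x) = y)) = ∅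
  · rw [hF, hne, Finset.image_empty, Finset.card_empty]
    exact Nat.zero_le _
  obtain ⟨b₀, hb₀⟩ := Finset.nonempty_iff_ne_empty.mpr hne
  obtain ⟨hb₀W, hb₀y⟩ := Finset.mem_filter.mp hb₀
  set tl := y.1.1 with ht
  have hwin₀ := hW b₀ hb₀W
  have htlev : D.lev (site b₀ : Fin (d + 1) → ℤ) = tl := lev_eq_of_blkOf_eq D hb₀y
  have ht_range : t.j ≤ tl ∧ tl ≤ t.j + 1 := by
    rw [← htlev]
    exact hlev _ (site b₀).2 hwin₀
  have hL1 : 1 ≤ ℓ + 1 := by omega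
  have hLpos : (0 : ℤ) < (((ℓ + 1) ^ t.j : ℕ) : ℤ) := by positivity
  have hdvd : ∀ μ, (((ℓ + 1) ^ t.j : ℕ) : ℤ) ∣ (((ℓ + 1) ^ tl : ℕ) : ℤ) * y.1.2 μ - x₀ μ := fun μ =>
    dvd_sub (dvd_mul_of_dvd_left (by exact_mod_cast pow_dvd_pow (ℓ + 1) ht_range.1) _) (hx₀ μ)
  set a : Fin (d + 1) → ℤ := fun μ => ((((ℓ + 1) ^ tl : ℕ) : ℤ) * y.1.2 μ - x₀ μ) / (((ℓ + 1) ^ t.j : ℕ) : ℤ) with ha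
  set B : Finset (Fin (d + 1) → ℤ) := Fintype.piFinset fun μ => Finset.Ico (a μ) (a μ + (ℓ + 1 : ℕ)) with hB
  have hBcard : B.card = (ℓ + 1) ^ (d + 1) := by
    rw [hB, Fintype.card_piFinset]
    simp only [Int.card_Ico, add_sub_cancel_left, Int.toNat_natCast, Finset.prod_const, Finset.card_univ,
      Fintype.card_fin]
  have hinto : ∀ s ∈ F, rep (Mk t.P t.j) s ∈ B := by
    intro s hs
    obtain ⟨b, hb, rfl⟩ := Finset.mem_image.mp hs
    obtain ⟨hbW, hby⟩ := Finset.mem_filter.mp hb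
    have hwin := hW b hbW
    have hz0 : ∀ μ, 0 ≤ (site b : Fin (d + 1) → ℤ) μ - x₀ μ := fun μ => by have := (hwin μ).1; linarith
    -- the ONE changed step: the window side is at most the fine period, so the charted point lies in the fundamental domain
    have hzN : ∀ μ, (site b : Fin (d + 1) → ℤ) μ - x₀ μ < (t.P.sitesPerDir 0 : ℕ) := fun μ => by
      have := (hwin μ).2
      have hc : ((Wd : ℕ) : ℤ) ≤ ((t.P.sitesPerDir 0 : ℕ) : ℤ) := by exact_mod_cast hWd
      linarith
    rw [hB, Fintype.mem_piFinset]
    intro μ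
    rw [Finset.mem_Ico, chartBond_src, rep_iterBlockOf_siteOfInt t hz0 hzN μ]
    obtain ⟨hlo, hhi⟩ := coord_bounds D hby μ
    have hlo' : (((ℓ + 1) ^ tl : ℕ) : ℤ) * y.1.2 μ - x₀ μ ≤ (site b : Fin (d + 1) → ℤ) μ - x₀ μ := by
      have : (((ℓ + 1) ^ y.1.1 : ℕ) : ℤ) = (((ℓ + 1) ^ tl : ℕ) : ℤ) := by rw [ht]
      linarith
    constructor
    · exact Int.ediv_le_ediv hLpos hlo'
    · refine Int.ediv_lt_of_lt_mul hLpos ?_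
      have hmul : a μ * (((ℓ + 1) ^ t.j : ℕ) : ℤ) = (((ℓ + 1) ^ tl : ℕ) : ℤ) * y.1.2 μ - x₀ μ :=
        Int.ediv_mul_cancel (hdvd μ)
      have hpow : (((ℓ + 1) ^ tl : ℕ) : ℤ) ≤ ((ℓ + 1 : ℕ) : ℤ) * (((ℓ + 1) ^ t.j : ℕ) : ℤ) := by
        rw [← Nat.cast_mul, ← pow_succ']
        exact_mod_cast Nat.pow_le_pow_right hL1 ht_range.2
      have hhi' : (site b : Fin (d + 1) → ℤ) μ < (((ℓ + 1) ^ tl : ℕ) : ℤ) * y.1.2 μ + (((ℓ + 1) ^ tl : ℕ) : ℤ) := by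
        have : (((ℓ + 1) ^ y.1.1 : ℕ) : ℤ) = (((ℓ + 1) ^ tl : ℕ) : ℤ) := by rw [ht]
        linarith
      nlinarith
  calc F.card ≤ B.card := Finset.card_le_card_of_injOn (rep (Mk t.P t.j)) hinto ((rep_injective t).injOn)
    _ = (ℓ + 1) ^ (d + 1) := hBcard

end Fibre

/-! ## §2  (2.133) on the V1 global torus through a large window with the reach in a shifted half-period sub-window -/

section Reach

variable {m K : ℕ}

/-- `(labels of b₋, direction)` determines the bond. [cite: Balaban1984PropagatorsII, p.224 («Ω also the set of bonds»), dictionary] -/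
private theorem injOn_pos_dir_V1 {Mh k : ℕ} {P' : Fin (d + 1) → ℕ} (hN : ∀ μ, N0 ℓ Mh k P' μ = (PV d ℓ m K hd hL).sitesPerDir 0)
    (W : Finset (PBond (PV d ℓ m K hd hL) 0)) :
    Set.InjOn (fun b : PBond (PV d ℓ m K hd hL) 0 => ((toBox hN b.src : Fin (d + 1) → ℤ), b.dir)) ↑W := by
  intro b _ b' _ h
  simp only [Prod.mk.injEq] at h
  obtain ⟨h1, h2⟩ := h
  have hsrc : b.src = b'.src := toBox_injective hN (Subtype.ext h1)
  cases b
  cases b'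
  simp only at hsrc h2
  subst hsrc
  subst h2
  rfl

/-- **(2.133) ⟹ `h2133` ON THE V1 GLOBAL TORUS THROUGH A LARGE WINDOW, REACH IN A SHIFTED HALF-PERIOD SUB-WINDOW**: ONE `δ₂ > 0`, ONE `A ≥ 0`
(on `d, L, a₀, a₁`; the constants of `B6GlobalChartV1L0.reach2133_G_V1`) such that for every two-scale member `t`, every V1 global torus whose
fundamental box is the torus (`hN`; `M_h ≥ 1`, `P′ ≥ 1`), every two-level window `[x₀, x₀ + Wd)` of side up to the FULL period `2L^{m_□+K_□}` with
corner `x₀ ∈ L^jℤ^{d+1}`, every finite set `W` of its bonds, every sub-window corner `x₁ ≥ x₀` with `L^j ∣ x₁ − x₀` and side `Wd₁ ≤ L^{m_□+K_□}`, and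
every reach `S ⊂ 𝔅` whose `W`-bonds lie in `[x₁, x₁ + Wd₁)`:
`LocalMajorant (blkV1 hN D) (GlV1 t hN W x₀) S (L^{d+1}·A·e^{2δ₂}·e^{−(δ₂/(d+1))·d_T})`.
[cite: Balaban1984PropagatorsII, (2.133) p.247, (2.90)–(2.91) p.239, p.238 (T_□ = □̃³), Prop. 2.6 p.247] -/
theorem reach2133_G_V1₂ (d ℓ : ℕ) (hd : 1 ≤ d + 1) (hL : Odd (ℓ + 1) ∧ 1 < ℓ + 1) {a₀ a₁ : ℝ} (ha₀ : 0 < a₀) (ha₁ : a₀ ≤ a₁) :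
    ∃ δ : ℝ, 0 < δ ∧ ∃ A : ℝ, 0 ≤ A ∧ ∀ (t : TSIdx d (ℓ + 1) hd hL a₀ a₁) (m K : ℕ) {Mh k R : ℕ} {P' : Fin (d + 1) → ℕ}
      (hN : ∀ μ, N0 ℓ Mh k P' μ = (PV d ℓ m K hd hL).sitesPerDir 0) (D : TDomains d ℓ Mh k P' R) (_ : 1 ≤ Mh) (_ : ∀ μ, 1 ≤ P' μ)
      (x₀ : Fin (d + 1) → ℤ) (_ : ∀ μ, (((ℓ + 1) ^ t.j : ℕ) : ℤ) ∣ x₀ μ) (Wd : ℕ) (_ : Wd ≤ t.P.sitesPerDir 0)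
      (_ : ∀ z ∈ boxDom (N0 ℓ Mh k P'), (∀ μ, x₀ μ ≤ z μ ∧ z μ < x₀ μ + Wd) → t.j ≤ D.lev z ∧ D.lev z ≤ t.j + 1)
      (W : Finset (PBond (PV d ℓ m K hd hL) 0))
      (_ : ∀ b ∈ W, InWindow (fun b : PBond (PV d ℓ m K hd hL) 0 => (toBox hN b.src : Fin (d + 1) → ℤ)) x₀ Wd b)
      (x₁ : Fin (d + 1) → ℤ) (_ : ∀ μ, (((ℓ + 1) ^ t.j : ℕ) : ℤ) ∣ x₁ μ - x₀ μ) (_ : ∀ μ, x₀ μ ≤ x₁ μ)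
      (Wd₁ : ℕ) (_ : Wd₁ ≤ (ℓ + 1) ^ (t.m + t.K)) (S : Set (geomT D).Site)
      (_ : ∀ b ∈ W, blkV1 hN D b ∈ S → InWindow (fun b : PBond (PV d ℓ m K hd hL) 0 => (toBox hN b.src : Fin (d + 1) → ℤ)) x₁ Wd₁ b),
      LocalMajorant (g := geomT D) (blkV1 hN D) (GlV1 t hN W x₀) S
        (fun a b => ((ℓ + 1) ^ (d + 1) : ℕ) * ((A * Real.exp (δ * ((d + 1 : ℝ) + (d + 1)) / (d + 1))) *
          Real.exp (-(δ / (d + 1) * (geomT D).dist a b)))) := by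
  obtain ⟨δ, hδ, A, hA, h⟩ := reach2133_G₂ d (ℓ + 1) hd hL ha₀ ha₁
  refine ⟨δ, hδ, A, hA, fun t m K Mh k R P' hN D hMh hP x₀ hx₀ Wd hWd hlev W hW x₁ hx₁ hx₀₁ Wd₁ hWd₁ S hS => ?_⟩
  classical
  refine h t (g := geomT D) (blkV1 hN D) S (fun b : PBond (PV d ℓ m K hd hL) 0 => (toBox hN b.src : Fin (d + 1) → ℤ)) (fun b => b.dir)
    x₀ hWd W hW (injOn_pos_dir_V1 hN W) x₁ hx₁ hx₀₁ hWd₁ hS (d + 1) (d + 1) (by positivity) (fun b hb b₁ hb₁ hbS hb₁S => ?_)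
    ((ℓ + 1) ^ (d + 1))
    (fun y _ => hfib_sites_full t D.toDomains (fun b : PBond (PV d ℓ m K hd hL) 0 => toBox hN b.src) (fun b => b.dir) x₀ hx₀ Wd hWd
      hlev W hW y)
  -- the distance input over the full window: `d_T ≤ d_box ≤ (d+1)(|·|_∞/L^j + 1)`
  have hbox := hglob_sites t D.toDomains hMh hP (fun b : PBond (PV d ℓ m K hd hL) 0 => toBox hN b.src) x₀ Wd
    (fun z hz hw => (hlev z hz hw).1) W hW Set.univ b hb b₁ hb₁ (Set.mem_univ _) (Set.mem_univ _)
  have hT : (((bondT D).dist (blkV1 hN D b) (blkV1 hN D b₁) : ℕ) : ℝ)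
      ≤ (((bond D.toDomains).dist (blkV1 hN D b) (blkV1 hN D b₁) : ℕ) : ℝ) := by
    exact_mod_cast distT_le_dist_box (D := D) hMh hP _ _
  exact hT.trans hbox

/-! ## §3  The same for the FULL bond window `cB` of a placed member (the window that carries `hinvl`) -/

/-- **(2.133) FOR THE FULL-WINDOW `GlV1` ON A REACH IN A SHIFTED HALF-PERIOD SUB-WINDOW**: the constants `δ, A` of `reach2133_G_V1₂` give, for every
two-scale member `t`, every V1 global torus whose fundamental box is the torus (`hN`), every corner `x₀ ≥ 0` with the full member period inside the box
(`hfit`), `L^j ∣ x₀`, the FULL window two-level, and every reach `S` all of whose bonds lie in a half-period sub-window `[x₁, x₁ + Wd₁)`, `x₁ ≥ x₀`,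
`L^j ∣ x₁ − x₀`, `Wd₁ ≤ L^{m_□+K_□}`:
`LocalMajorant (blkV1 hN D) (GlV1 t hN (cB t x₀ hx₀ hfit).W x₀) S (L^{d+1}·A·e^{2δ}·e^{−(δ/(d+1))·d_T})` — the re-centred cube's `h2133` input
(`B6CubeWindowV1L3.h2133C`, sub-window corner `x1C = ctr − 3S_j/2`). [cite: Balaban1984PropagatorsII, (2.133) p.247, (2.90)–(2.91) p.239, p.238 (T_□ = □̃³)] -/
theorem reach2133_G_V1_full₂ (d ℓ : ℕ) (hd : 1 ≤ d + 1) (hL : Odd (ℓ + 1) ∧ 1 < ℓ + 1) {a₀ a₁ : ℝ} (ha₀ : 0 < a₀) (ha₁ : a₀ ≤ a₁) :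
    ∃ δ : ℝ, 0 < δ ∧ ∃ A : ℝ, 0 ≤ A ∧ ∀ (t : TSIdx d (ℓ + 1) hd hL a₀ a₁) (m K : ℕ) {Mh k R : ℕ} {P' : Fin (d + 1) → ℕ}
      (hN : ∀ μ, N0 ℓ Mh k P' μ = (PV d ℓ m K hd hL).sitesPerDir 0) (D : TDomains d ℓ Mh k P' R) (_ : 1 ≤ Mh) (_ : ∀ μ, 1 ≤ P' μ)
      (x₀ : Fin (d + 1) → ℤ) (hx₀ : ∀ μ, 0 ≤ x₀ μ) (hfit : ∀ μ, x₀ μ + (t.P.sitesPerDir 0 : ℕ) ≤ ((PV d ℓ m K hd hL).sitesPerDir 0 : ℕ))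
      (_ : ∀ μ, (((ℓ + 1) ^ t.j : ℕ) : ℤ) ∣ x₀ μ)
      (_ : ∀ z ∈ boxDom (N0 ℓ Mh k P'), (∀ μ, x₀ μ ≤ z μ ∧ z μ < x₀ μ + (t.P.sitesPerDir 0 : ℕ)) → t.j ≤ D.lev z ∧ D.lev z ≤ t.j + 1)
      (x₁ : Fin (d + 1) → ℤ) (_ : ∀ μ, (((ℓ + 1) ^ t.j : ℕ) : ℤ) ∣ x₁ μ - x₀ μ) (_ : ∀ μ, x₀ μ ≤ x₁ μ)
      (Wd₁ : ℕ) (_ : Wd₁ ≤ (ℓ + 1) ^ (t.m + t.K)) (S : Set (geomT D).Site)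
      (_ : ∀ b : PBond (PV d ℓ m K hd hL) 0, blkV1 hN D b ∈ S →
        InWindow (fun b : PBond (PV d ℓ m K hd hL) 0 => (toBox hN b.src : Fin (d + 1) → ℤ)) x₁ Wd₁ b),
      LocalMajorant (g := geomT D) (blkV1 hN D) (GlV1 t hN (cB t x₀ hx₀ hfit).W x₀) S
        (fun a b => ((ℓ + 1) ^ (d + 1) : ℕ) * ((A * Real.exp (δ * ((d + 1 : ℝ) + (d + 1)) / (d + 1))) *
          Real.exp (-(δ / (d + 1) * (geomT D).dist a b)))) := by
  obtain ⟨δ, hδ, A, hA, h⟩ := reach2133_G_V1₂ d ℓ hd hL ha₀ ha₁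
  refine ⟨δ, hδ, A, hA, fun t m K Mh k R P' hN D hMh hP x₀ hx₀ hfit hdiv hlev x₁ hx₁ hx₀₁ Wd₁ hWd₁ S hS => ?_⟩
  classical
  refine h t m K hN D hMh hP x₀ hdiv (t.P.sitesPerDir 0) le_rfl hlev (cB t x₀ hx₀ hfit).W (fun b hb μ => ?_) x₁ hx₁ hx₀₁ Wd₁ hWd₁ S
    (fun b _ hbS => hS b hbS)
  -- a bond of the full bond window has its initial point in the full site window
  have hw := (mem_cB_W.1 hb) μ
  simp only [toBox_apply]
  constructor
  · linarith [hw.1]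
  · linarith [hw.2]

end Reach

end Literature.MathematicalPhysics.QuantumFieldTheory.Balaban1983to89.B6FullWindowReachV1L3

end
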